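import Mathlib
import Summits.Ventures.PercRepro2.PMK5Deg3Kernel
import Summits.Ventures.PercRepro2.PMK5Deg4Kernel
import Summits.Ventures.PercRepro2.PMK5Deg4Kernel5
import Summits.Ventures.PercRepro2.PMK5Deg5Kernel
import Summits.Ventures.PercRepro2.PMK5Deg5Kernel6
import Summits.Ventures.PercRepro2.PMK5Deg5LitsK68
import Summits.Ventures.PercRepro2.PMK5Deg5CertK6
import Summits.Ventures.PercRepro2.Deg5Conn
import Summits.Ventures.PercRepro2.Deg5Typed

/-!
# THEOREM 30: ROW 2′TRI AND (HCOV) ON `K₆` FOR EVERY WEIGHT VECTOR — THE LAST SIX-VERTEX CASE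
(blind cell PercRepro2, mine-2 g29; the degree-5 rung: `a₃` adjacent to all five other vertices, fifteen edges)

The `4096` six-digit slice certificates `cert_k6` (`PMK5Deg5CertsK6*.lean`, assembled by the first three digits in
`PMK5Deg5CertK6D*.lean` and `PMK5Deg5CertK6.lean`) and the `1216` certified literals `Six.litOK_k6`
(`PMK5Deg5LitsK60–8.lean`), read through the six-digit slice decomposition and the digit bridge by
`Deg5Typed.HCov_deg5`.  With Theorems 14 / 16 / 27 / 28 / 29 (`Deg3All`, `Deg4All`) this closes (HCOV) and row 2′TRI
in the kernel on EVERY six-vertex graph with the five marks at `(o, a₁, a₂, a₃, b) = (0, 1, 2, 5, 4)` and one unmarked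
vertex, for every weight vector (missing edges at weight `0`).  Standard axioms only.
-/

namespace Summit.Ventures.PercRepro2

namespace Deg5

variable {R : Type*} [Field R] [LinearOrder R] [IsStrictOrderedRing R]

/-- **Row 2′TRI on `K₆`**: every weight-free typed count of `K₃` is nonnegative. -/
theorem typedBases_k6 : CovForm.TypedBases (R := R) ends15 0 1 2 5 4 :=
  typedBases Six.litOK_k6 cert_k6

/-- **THEOREM 30: (HCOV) on `K₆` for every weight vector** (missing edges at weight `0`) — the last six-vertex
case; with `Deg3All.HCov_deg3_all` and `Deg4All.HCov_deg4_all`, (HCOV) holds on every six-vertex marked graph. -/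
theorem HCov_k6 (p : Fin 15 → R) (hp : IsProbVec p) : CovForm.HCov p ends15 0 1 2 5 4 :=
  HCov_deg5 Six.litOK_k6 cert_k6 p hp

end Deg5

end Summit.Ventures.PercRepro2
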